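import Summits.ResolutionOfSingularities.ResolutionOfSingularities.Theorems.EquisingularLiftEquisingularLiftNatTowerFrameSupply
import Literature.AlgebraicGeometry.Resolution.AlterationsSemiStableCodimTwoBlowupFormal
import Mathlib.RingTheory.Ideal.Height
import Mathlib.RingTheory.Ideal.GoingUp
import Mathlib.AlgebraicGeometry.Morphisms.Finite
import Mathlib.AlgebraicGeometry.Noetherian
import HarnessLib

/-!
# [OURS · L1 W4.5(b) · EL♮(3)] DEF-TOWER₆ brick B3 — the fibre-dimension datum moves along a FULL multisection

Crux chain w45b (cell `res-hironaka`, slot W4.5(b)), child crux **EL♮(3)** = stmt-ResolutionOfSingularities-20148, route EquisingularLift;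
TWENTY-FIRST plumbing rung DEF-TOWER₆ (owner res-L1-w45b-stub-4 g9), engine stand-in `hB3`, brick **B3** (desk DEAL
`res-hironaka/STATUS.md` 2026-08-28T02:20:48Z; signature `L/res-L1-w45b-stub-4/B3-towerFull-dim.sig.lean` 6aa4b2923cab98a0, VERBATIM). Written by
res-D-pv-035 g9. HONEST FRAMING: OURS; NOT a statement of any manuscript; AI-written, weaker than expert review. No `sorry`; standard axioms;
DEF-FREE. `--supports stmt-ResolutionOfSingularities-20148 --as helper`.

WHAT. `TowerFull` gives `δ : Z̃ ⟶ Z̃₉` FINITE, FLAT, surjective. For a closed point `z ∈ Z̃`: `δ z` is closed (finite ⇒ universally closed ⇒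
closed map), so `dim 𝒪_{Z̃₉, δ z} = 1`; flatness gives `dim 𝒪_{Z̃₉, δ z} ≤ dim 𝒪_{Z̃, z}` (tree `ringKrullDim_stalk_le_of_flat`, Matsumura 15.1);
finiteness gives `dim 𝒪_{Z̃, z} ≤ dim 𝒪_{Z̃₉, δ z}` by HEIGHTS on an affine `V ∋ δ z` and `U := δ⁻¹V`: `Γ(V) → Γ(U)` is finite hence integral, so
contraction of primes is strictly monotone (`Ideal.IsIntegral.comap_lt_comap`, incomparability), heights do not increase
(`Order.height_le_height_apply_of_strictMono`), the prime of `z` contracts to the prime of `δ z` (Mathlib `comap_primeIdealOf_appLE`), and the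
stalks are the localisations at those primes (`IsLocalization.AtPrime.ringKrullDim_eq_height`).
* `ringKrullDim_stalk_le_of_isFinite` — the finite half, for any finite morphism of schemes (target locally Noetherian not needed).
* `ringKrullDim_stalk_eq_of_isFinite_of_flat` — equality for finite flat morphisms of locally Noetherian schemes.
* `ringKrullDim_redSub_stalk_eq_one_of_towerFull` — **B3**, the sig verbatim (twin of `ringKrullDim_redSub_stalk_eq_of_dirStepSec`).

References (method): H. Matsumura, *Commutative Ring Theory* (1986), Thms. 9.4, 15.1; index only.
-/

set_option linter.dupNamespace false -- mandated namespace `Summit.<Summit>.<Problem>` of this single-conjunct summit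

noncomputable section

open CategoryTheory AlgebraicGeometry TopologicalSpace
open Literature.AlgebraicGeometry.Resolution

namespace Summit.ResolutionOfSingularities.ResolutionOfSingularities.Cruxes.EquisingularLiftNat.Sections

universe u

/-- **Along a finite morphism the dimension of the local ring does not increase**: `dim 𝒪_{X,x} ≤ dim 𝒪_{Y,f x}` (heights of the primes of
`x` and `f x` in `Γ(f⁻¹V) ⊇ Γ(V)`, a finite hence integral extension: contraction of primes is strictly monotone by incomparability).
[folklore; Matsumura1987 Thm. 9.4, index only] -/
theorem ringKrullDim_stalk_le_of_isFinite {X Y : Scheme.{u}} (f : X ⟶ Y) [IsFinite f] (x : X) :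
    ringKrullDim (X.presheaf.stalk x) ≤ ringKrullDim (Y.presheaf.stalk (f x)) := by
  classical
  -- an affine `V ∋ f x` and its affine preimage `U ∋ x`
  obtain ⟨V, hV, hxV, -⟩ := exists_isAffineOpen_mem_and_subset (X := Y) (x := f x) (U := ⊤) (Opens.mem_top _)
  have hU : IsAffineOpen (f ⁻¹ᵁ V) := hV.preimage f
  have hxU : x ∈ f ⁻¹ᵁ V := hxV
  -- the ring map `Γ(V) → Γ(f⁻¹V)` is finite, hence integral
  let φ := f.appLE V (f ⁻¹ᵁ V) le_rfl
  letI : Algebra Γ(Y, V) Γ(X, f ⁻¹ᵁ V) := φ.hom.toAlgebra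
  haveI : Module.Finite Γ(Y, V) Γ(X, f ⁻¹ᵁ V) := by
    have h := IsFinite.finite_app f V hV
    rw [Scheme.Hom.app_eq_appLE] at h
    exact h
  haveI : Algebra.IsIntegral Γ(Y, V) Γ(X, f ⁻¹ᵁ V) := Algebra.IsIntegral.of_finite _ _
  -- contraction of primes is strictly monotone
  have hmono : StrictMono (PrimeSpectrum.comap φ.hom) := by
    intro q₁ q₂ hlt
    rw [← PrimeSpectrum.asIdeal_lt_asIdeal] at hlt ⊢
    rw [PrimeSpectrum.comap_asIdeal, PrimeSpectrum.comap_asIdeal]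
    exact Ideal.IsIntegral.comap_lt_comap hlt
  -- the primes of `x` and `f x`
  set q : PrimeSpectrum Γ(X, f ⁻¹ᵁ V) := hU.primeIdealOf ⟨x, hxU⟩ with hq
  set p : PrimeSpectrum Γ(Y, V) := hV.primeIdealOf ⟨f x, hxV⟩ with hp
  have hpq : PrimeSpectrum.comap φ.hom q = p :=
    IsAffineOpen.comap_primeIdealOf_appLE V hV (f ⁻¹ᵁ V) hU le_rfl hxU
  -- stalks are the localisations at those primes
  letI := X.presheaf.algebra_section_stalk (⟨x, hxU⟩ : (f ⁻¹ᵁ V : X.Opens))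
  letI := Y.presheaf.algebra_section_stalk (⟨f x, hxV⟩ : (V : Y.Opens))
  haveI : IsLocalization.AtPrime (X.presheaf.stalk x) q.asIdeal := hU.isLocalization_stalk ⟨x, hxU⟩
  haveI : IsLocalization.AtPrime (Y.presheaf.stalk (f x)) p.asIdeal := hV.isLocalization_stalk ⟨f x, hxV⟩
  rw [IsLocalization.AtPrime.ringKrullDim_eq_height q.asIdeal (X.presheaf.stalk x),
    IsLocalization.AtPrime.ringKrullDim_eq_height p.asIdeal (Y.presheaf.stalk (f x)),
    PrimeSpectrum.height_eq_orderHeight, PrimeSpectrum.height_eq_orderHeight, ← hpq]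
  exact_mod_cast Order.height_le_height_apply_of_strictMono _ hmono q

/-- **Finite flat morphisms preserve the dimension of the local rings** (locally Noetherian schemes): `dim 𝒪_{X,x} = dim 𝒪_{Y,f x}`.
[folklore; Matsumura1987 Thms. 9.4, 15.1, index only] -/
theorem ringKrullDim_stalk_eq_of_isFinite_of_flat {X Y : Scheme.{u}} (f : X ⟶ Y) [IsFinite f] [Flat f]
    [IsLocallyNoetherian X] [IsLocallyNoetherian Y] (x : X) :
    ringKrullDim (X.presheaf.stalk x) = ringKrullDim (Y.presheaf.stalk (f x)) :=
  le_antisymm (ringKrullDim_stalk_le_of_isFinite f x) (ringKrullDim_stalk_le_of_flat f x)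

/-- **B3 — the fibre-dimension datum moves along a FULL multisection**: `TowerFull` (`δ : Z̃ ⟶ Z̃₉` finite, flat, surjective) and
«closed points of `Z̃₉` have 1-dimensional local rings» give the same for `Z̃`. Twin of `ringKrullDim_redSub_stalk_eq_of_dirStepSec`
(…NatTowerFrameSupply). [OURS · L1 W4.5b · DEF-TOWER₆ brick B3 (res-L1-w45b-stub-4 sig 6aa4b2923cab98a0, verbatim); method Matsumura1987
Thm. 15.1, index only] -/
theorem ringKrullDim_redSub_stalk_eq_one_of_towerFull {F₉ F₁₀ : Scheme.{0}} {υ' : F₁₀ ⟶ F₉} {Z₉ : Set F₉} {hZ₉ : IsClosed Z₉}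
    {G : Scheme.{0}} {γ : G ⟶ F₁₀} {Z : Set G} {hZ : IsClosed Z} [IsLocallyNoetherian F₉] [IsLocallyNoetherian G]
    (hfull : TowerFull F₉ F₁₀ υ' Z₉ hZ₉ G γ Z hZ)
    (h₉ : ∀ z₉ : ↥(redSub F₉ Z₉ hZ₉), IsClosed ({z₉} : Set ↥(redSub F₉ Z₉ hZ₉)) →
      ringKrullDim ((redSub F₉ Z₉ hZ₉).presheaf.stalk z₉) = ((1 : ℕ) : WithBot ℕ∞)) :
    ∀ z : ↥(redSub G Z hZ), IsClosed ({z} : Set ↥(redSub G Z hZ)) → ringKrullDim ((redSub G Z hZ).presheaf.stalk z) = ((1 : ℕ) : WithBot ℕ∞) := by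
  intro z hz
  obtain ⟨δ, -, hfin, hflat, -⟩ := hfull
  haveI := hfin
  haveI := hflat
  haveI : IsLocallyNoetherian (redSub G Z hZ) := LocallyOfFiniteType.isLocallyNoetherian (redSubι G Z hZ)
  haveI : IsLocallyNoetherian (redSub F₉ Z₉ hZ₉) := LocallyOfFiniteType.isLocallyNoetherian (redSubι F₉ Z₉ hZ₉)
  -- `δ z` is a closed point (finite morphisms are closed)
  have hδz : IsClosed ({δ z} : Set ↥(redSub F₉ Z₉ hZ₉)) := by
    have h := δ.isClosedMap _ hz
    rwa [Set.image_singleton] at h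
  rw [ringKrullDim_stalk_eq_of_isFinite_of_flat δ z]
  exact h₉ _ hδz

end Summit.ResolutionOfSingularities.ResolutionOfSingularities.Cruxes.EquisingularLiftNat.Sections

end
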